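import Literature.Probability.Percolation.ArmSeparationExtGuard
import Literature.Probability.Percolation.ArmSeparationInnerFrames
import Literature.Probability.Percolation.TriBallDisc
import HarnessLib

/-!
# Cyclic order of fenced outer tips: from the perimeter certificate to row gaps on a common side

Topic: Probability / Percolation; family `crit-perc` / near-critical percolation on `𝕋`. A brick
of the four-arm, alternating-colour case (`j = 4`, `σ = BWBW`) of Kesten's arm separation theorem
(Nolin 2008, Thm. 11 [arXiv 0711.4948: Thm. 10]). The outer step (`ArmSeparationOutFramesFour.lean`,
`OutMidTiny4`) delivers four fenced tips `ζ_j = frameIso (i j) z_j ∈ ∂Λ_{2M}` (`z_j ∈ trapO M`,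
middle tips `GoodTip M R₀ z_j`) in a certified anticlockwise cyclic order, as strict inequalities of
the shifted perimeter coordinate `hexShift (2M) r` (`TriBallDisc.lean`). The landing step separates
two tips on a COMMON side by a row gap; for tips of different colours the gap comes from the fences
(`row_gap_of_lt`), for tips of the same colour it comes from the tip of the other colour which the
cyclic order places BETWEEN them. This file turns the certificate into that statement:

* `sbtw_of_hexShift_lt` — four points in cyclic order `a < b < c < d`: linearly (in `hexPos`),
  `b` or `d` lies strictly between `a` and `c`, and `a` or `c` strictly between `b` and `d`;
* `hexPos_frameIso_trapO`, `hexPos_frameIso_affine` — the perimeter coordinate of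
  `frameIso i z`, `z ∈ trapO M` off the lower corner, is affine in the row `z 1` with slope `+1`
  (`i = 0, 1, 3, 4`, rotations) or `-1` (`i = 2, 5`, reflections), a middle tip's within the block
  `[2M i + R₀, 2M (i+1) - R₀]` of side `i`;
* `frame_eq_and_row_sbtw` — a middle tip whose perimeter coordinate is between those of two
  middle tips of frame `i` is itself of frame `i`, with row strictly between theirs.

Everything here is proved; no named facts are introduced.

## References

* P. Nolin, *Near-critical percolation in two dimensions*, Electron. J. Probab. 13 (2008), §4.1
  (arms in cyclic order), §4.4 [arXiv 0711.4948: proof of Thm. 10]. [Nolin2008]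
-/

noncomputable section

namespace Literature.Probability.Percolation

open LatticeModels

/-- Strict linear betweenness of an integer between two others, in either order. [folklore] -/
def SBtw (x y z : ℤ) : Prop := (x < y ∧ y < z) ∨ (z < y ∧ y < x)

/-- **Cyclic order to linear betweenness.** If `a, b, c, d ∈ ∂Λ_N` are in strict cyclic order from
an origin `r ∈ ∂Λ_N` (`hexShift N r a < hexShift N r b < hexShift N r c < hexShift N r d`), then in
the linear perimeter coordinate `hexPos N`, `b` or `d` lies strictly between `a` and `c`, and `a`
or `c` lies strictly between `b` and `d` (the linear order is a rotation of `(a, b, c, d)`). [folklore] -/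
theorem sbtw_of_hexShift_lt {N : ℕ} (hN : 1 ≤ N) {r a b c d : Site 2} (hr : triNorm r = N)
    (ha : triNorm a = N) (hb : triNorm b = N) (hc : triNorm c = N) (hd : triNorm d = N)
    (h₁ : hexShift N r a < hexShift N r b) (h₂ : hexShift N r b < hexShift N r c) (h₃ : hexShift N r c < hexShift N r d) :
    (SBtw (hexPos N a) (hexPos N b) (hexPos N c) ∨ SBtw (hexPos N a) (hexPos N d) (hexPos N c)) ∧
      (SBtw (hexPos N b) (hexPos N a) (hexPos N d) ∨ SBtw (hexPos N b) (hexPos N c) (hexPos N d)) := by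
  have rr := hexPos_range hN hr
  have ra := hexPos_range hN ha
  have rb := hexPos_range hN hb
  have rc := hexPos_range hN hc
  have rd := hexPos_range hN hd
  unfold hexShift at h₁ h₂ h₃
  unfold SBtw
  split_ifs at h₁ h₂ h₃ <;> omega

/-- **The perimeter coordinate of a framed tip**, frame by frame: for `z ∈ trapO M` off the
lower corner (`-2M < z 1`), `hexPos (2M) (frameIso i z)` is `z 1 + 2M`, `4M + z 1`, `4M - z 1`,
`8M + z 1`, `10M + z 1`, `10M - z 1` for `i = 0, …, 5` (affine in the row, slope `+1` for the
rotations `i = 0, 1, 3, 4`, slope `-1` for the reflections `i = 2, 5`). [folklore] -/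
theorem hexPos_frameIso_trapO {M : ℕ} {z : Site 2} (hz : z ∈ trapO M) (hz1 : -(2 * (M : ℤ)) < z 1) :
    hexPos (2 * M) (frameIso 0 z) = z 1 + 2 * M ∧ hexPos (2 * M) (frameIso 1 z) = 4 * M + z 1 ∧
    hexPos (2 * M) (frameIso 2 z) = 4 * M - z 1 ∧ hexPos (2 * M) (frameIso 3 z) = 8 * M + z 1 ∧
    hexPos (2 * M) (frameIso 4 z) = 10 * M + z 1 ∧ hexPos (2 * M) (frameIso 5 z) = 10 * M - z 1 := by
  obtain ⟨h0, -, h1'⟩ := trapO_coord hz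
  obtain ⟨e00, e01, e10, e11, e20, e21, e30, e31, e40, e41, e50, e51⟩ := frameIso_apply_formula z
  generalize hw0 : frameIso 0 z = w0 at e00 e01
  generalize hw1 : frameIso 1 z = w1 at e10 e11
  generalize hw2 : frameIso 2 z = w2 at e20 e21
  generalize hw3 : frameIso 3 z = w3 at e30 e31
  generalize hw4 : frameIso 4 z = w4 at e40 e41
  generalize hw5 : frameIso 5 z = w5 at e50 e51
  rw [hexPos_of_coord (2 * M) w0 _ _ e00 e01, hexPos_of_coord (2 * M) w1 _ _ e10 e11,
    hexPos_of_coord (2 * M) w2 _ _ e20 e21, hexPos_of_coord (2 * M) w3 _ _ e30 e31,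
    hexPos_of_coord (2 * M) w4 _ _ e40 e41, hexPos_of_coord (2 * M) w5 _ _ e50 e51]
  rcases lt_or_eq_of_le h1' with hlt | heq
  · -- `z 1 < 0`
    refine ⟨?_, ?_, ?_, ?_, ?_, ?_⟩
    · rw [if_pos ⟨by omega, hlt⟩]; omega
    · rw [if_neg (by omega), if_pos ⟨by omega, by omega⟩]; omega
    · rw [if_neg (by omega), if_neg (by omega), if_pos ⟨by omega, by omega⟩]; omega
    · rw [if_neg (by omega), if_neg (by omega), if_neg (by omega), if_pos ⟨by omega, by omega⟩]; omega
    · rw [if_neg (by omega), if_neg (by omega), if_neg (by omega), if_neg (by omega), if_pos ⟨by omega, hlt⟩]; omega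
    · rw [if_neg (by omega), if_neg (by omega), if_neg (by omega), if_neg (by omega), if_neg (by omega)]; omega
  · -- `z 1 = 0`
    refine ⟨?_, ?_, ?_, ?_, ?_, ?_⟩
    · rw [if_neg (by omega), if_pos ⟨by omega, by omega⟩]; omega
    · rw [if_neg (by omega), if_neg (by omega), if_pos ⟨by omega, by omega⟩]; omega
    · rw [if_neg (by omega), if_neg (by omega), if_pos ⟨by omega, by omega⟩]; omega
    · rw [if_neg (by omega), if_neg (by omega), if_neg (by omega), if_neg (by omega), if_pos ⟨by omega, by omega⟩]; omega
    · rw [if_neg (by omega), if_neg (by omega), if_neg (by omega), if_neg (by omega), if_neg (by omega)]; omega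
    · rw [if_neg (by omega), if_neg (by omega), if_neg (by omega), if_neg (by omega), if_neg (by omega)]; omega

/-- **The perimeter coordinate of a framed MIDDLE tip, as `± row + offset`**: for `i < 6` there
are a sign `ε ∈ {1, -1}` and the offset of side `i` with
`hexPos (2M) (frameIso i z) = ε · z 1 + offset`, the value lying in the block
`[2M i + R₀, 2M (i+1) - R₀]`. [folklore] -/
theorem hexPos_frameIso_affine {M R₀ : ℕ} {z : Site 2} (hz : z ∈ trapO M) (hg : GoodTip M R₀ z) (hR₀ : 1 ≤ R₀)
    {i : ℕ} (hi : i < 6) :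
    ∃ ε off : ℤ, (ε = 1 ∨ ε = -1) ∧ hexPos (2 * M) (frameIso i z) = ε * z 1 + off ∧
      (i = 0 → ε = 1 ∧ off = 2 * M) ∧ (i = 1 → ε = 1 ∧ off = 4 * M) ∧ (i = 2 → ε = -1 ∧ off = 4 * M) ∧
      (i = 3 → ε = 1 ∧ off = 8 * M) ∧ (i = 4 → ε = 1 ∧ off = 10 * M) ∧ (i = 5 → ε = -1 ∧ off = 10 * M) ∧
      2 * (M : ℤ) * i + R₀ ≤ hexPos (2 * M) (frameIso i z) ∧ hexPos (2 * M) (frameIso i z) ≤ 2 * (M : ℤ) * (i + 1) - R₀ := by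
  obtain ⟨hg1, hg2⟩ := hg
  have hz1 : -(2 * (M : ℤ)) < z 1 := by omega
  obtain ⟨f0, f1, f2, f3, f4, f5⟩ := hexPos_frameIso_trapO hz hz1
  interval_cases i
  · exact ⟨1, 2 * M, Or.inl rfl, by rw [f0]; ring, fun _ => ⟨rfl, rfl⟩, by omega, by omega, by omega, by omega, by omega,
      by rw [f0]; push_cast; omega, by rw [f0]; push_cast; omega⟩
  · exact ⟨1, 4 * M, Or.inl rfl, by rw [f1]; ring, by omega, fun _ => ⟨rfl, rfl⟩, by omega, by omega, by omega, by omega,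
      by rw [f1]; push_cast; omega, by rw [f1]; push_cast; omega⟩
  · exact ⟨-1, 4 * M, Or.inr rfl, by rw [f2]; ring, by omega, by omega, fun _ => ⟨rfl, rfl⟩, by omega, by omega, by omega,
      by rw [f2]; push_cast; omega, by rw [f2]; push_cast; omega⟩
  · exact ⟨1, 8 * M, Or.inl rfl, by rw [f3]; ring, by omega, by omega, by omega, fun _ => ⟨rfl, rfl⟩, by omega, by omega,
      by rw [f3]; push_cast; omega, by rw [f3]; push_cast; omega⟩
  · exact ⟨1, 10 * M, Or.inl rfl, by rw [f4]; ring, by omega, by omega, by omega, by omega, fun _ => ⟨rfl, rfl⟩, by omega,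
      by rw [f4]; push_cast; omega, by rw [f4]; push_cast; omega⟩
  · exact ⟨-1, 10 * M, Or.inr rfl, by rw [f5]; ring, by omega, by omega, by omega, by omega, by omega, fun _ => ⟨rfl, rfl⟩,
      by rw [f5]; push_cast; omega, by rw [f5]; push_cast; omega⟩

/-- **A middle tip between two middle tips of frame `i` is of frame `i`, with row strictly
between theirs** (the perimeter coordinate of a middle tip of frame `i` lies in the block
`[2M i + R₀, 2M (i+1) - R₀]`, and is affine in the row with slope `±1`). [folklore] -/
theorem frame_eq_and_row_sbtw {M R₀ : ℕ} (hR₀ : 1 ≤ R₀) {za zb zc : Site 2} {i i' : ℕ} (hi : i < 6) (hi' : i' < 6)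
    (hza : za ∈ trapO M) (hzb : zb ∈ trapO M) (hzc : zc ∈ trapO M)
    (hga : GoodTip M R₀ za) (hgb : GoodTip M R₀ zb) (hgc : GoodTip M R₀ zc)
    (h : SBtw (hexPos (2 * M) (frameIso i za)) (hexPos (2 * M) (frameIso i' zb)) (hexPos (2 * M) (frameIso i zc))) :
    i' = i ∧ SBtw (za 1) (zb 1) (zc 1) := by
  obtain ⟨εa, oa, hεa, fa, a0, a1, a2, a3, a4, a5, ba1, ba2⟩ := hexPos_frameIso_affine hza hga hR₀ hi
  obtain ⟨εb, ob, hεb, fb, b0, b1, b2, b3, b4, b5, bb1, bb2⟩ := hexPos_frameIso_affine hzb hgb hR₀ hi'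
  obtain ⟨εc, oc, hεc, fc, c0, c1, c2, c3, c4, c5, bc1, bc2⟩ := hexPos_frameIso_affine hzc hgc hR₀ hi
  have hii : i' = i := by
    unfold SBtw at h
    have hM : (0 : ℤ) ≤ M := by positivity
    interval_cases i <;> interval_cases i' <;> first | rfl | (exfalso; push_cast at ba1 ba2 bb1 bb2 bc1 bc2; omega)
  subst hii
  refine ⟨rfl, ?_⟩
  unfold SBtw at h ⊢
  rw [fa, fb, fc] at h
  interval_cases i'
  · obtain ⟨rfl, rfl⟩ := a0 rfl; obtain ⟨rfl, rfl⟩ := b0 rfl; obtain ⟨rfl, rfl⟩ := c0 rfl; omega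
  · obtain ⟨rfl, rfl⟩ := a1 rfl; obtain ⟨rfl, rfl⟩ := b1 rfl; obtain ⟨rfl, rfl⟩ := c1 rfl; omega
  · obtain ⟨rfl, rfl⟩ := a2 rfl; obtain ⟨rfl, rfl⟩ := b2 rfl; obtain ⟨rfl, rfl⟩ := c2 rfl; omega
  · obtain ⟨rfl, rfl⟩ := a3 rfl; obtain ⟨rfl, rfl⟩ := b3 rfl; obtain ⟨rfl, rfl⟩ := c3 rfl; omega
  · obtain ⟨rfl, rfl⟩ := a4 rfl; obtain ⟨rfl, rfl⟩ := b4 rfl; obtain ⟨rfl, rfl⟩ := c4 rfl; omega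
  · obtain ⟨rfl, rfl⟩ := a5 rfl; obtain ⟨rfl, rfl⟩ := b5 rfl; obtain ⟨rfl, rfl⟩ := c5 rfl; omega

end Literature.Probability.Percolation
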